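import Mathlib.Analysis.Complex.AbsMax
import Mathlib.Analysis.Complex.LocallyUniformLimit
import Mathlib.Analysis.Analytic.IsolatedZeros
import Mathlib.Analysis.Normed.Group.FunctionSeries
import Literature.Analysis.Complex.HutchinsonMultiplier
import HarnessLib

/-!
# Hutchinson's theorem (forward direction) — proof

Topic `Literature/Analysis/Complex`. This file DISCHARGES the named fact
`Literature.Analysis.Complex.Hutchinson1923_thmB` of `HutchinsonMultiplier.lean`:

* `Hutchinson1923_thmB_holds : Hutchinson1923_thmB` — for `f(z) = Σ a_k z^k` entire with
  `a_k > 0` and `a_{n-1}² ≥ 4 a_{n-2} a_n` (`n ≥ 2`), every zero of `f` is real and negative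
  [Hutchinson1923; as quoted in NguyenVishnyakova2019, p. 3 Thm. B (i)].

Intermediate results (namespace `Literature.Analysis.Complex.Hutchinson1923`), all proved:
alternating-sum brackets for monotone sequences (`altSum_bounds`, `altSum_lower_one`,
`altSum_lower_three`, `leftAlt_bounds`), Hutchinson's sign pattern of the sections at the points
`-2 a_m / a_{m+1}` (`sign_at`), and real-rootedness of the sections `Σ_{k ≤ N} a_k z^k`, `N ≥ 3`
(`sections_zero_real_neg`). The passage to the entire function is Hurwitz's argument, done here
with the maximum modulus principle for `1/S_N` (Mathlib has no Hurwitz theorem as such).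

## References

* J. I. Hutchinson, *On a remarkable class of entire functions*, Trans. Amer. Math. Soc. 25 (1923)
  325–332, doi:10.2307/1989293 [Hutchinson1923].
* T. H. Nguyen, A. Vishnyakova, JMAA 480 (2019) 123433, arXiv:1903.09070, p. 3 Thm. B
  [NguyenVishnyakova2019].
-/

noncomputable section

namespace Literature.Analysis.Complex

open Polynomial

/-! ## The argument

We follow the classical argument of [Hutchinson1923] (sections first, then a Hurwitz-type
passage to the limit; statement as quoted in [NguyenVishnyakova2019, p. 3 Thm. B]): with
`x_k = a_{k-1}/a_k` the hypothesis reads `x_{k+1} ≥ 4 x_k`; at `r = 2 x_m` the terms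
`T_k = a_k r^k` at least double up to index `m` and at least halve after it, with
`T_m = 2 T_{m-1}`, so the alternating sum
`(-1)^m S_N(-r)` over a section `S_N = Σ_{k ≤ N} a_k z^k` (`N ≥ 3`) is positive (alternating
sums of monotone sequences). With `S_N(0) = a_0 > 0` this gives `N` sign changes on the
negative axis, hence `N` simple negative zeros and — by degree — no other complex zeros. The
entire function is the locally uniform limit of its sections; a zero `z₀` off the negative axis
is isolated (identity principle, `f(0) = a_0 ≠ 0`), and the maximum modulus principle applied to
`1/S_N` on a small disc about `z₀` (Hurwitz's argument) yields a contradiction. -/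

namespace Hutchinson1923

/-! ### Alternating sums of monotone sequences -/

/-- Peeling the first term off an alternating sum:
`Σ_{j ≤ M} (-1)^j u_j = u_0 - Σ_{j<M} (-1)^j u_{j+1}`. [folklore] -/
theorem altSum_succ (u : ℕ → ℝ) (M : ℕ) :
    ∑ j ∈ Finset.range (M + 1), (-1 : ℝ) ^ j * u j
      = u 0 - ∑ j ∈ Finset.range M, (-1 : ℝ) ^ j * u (j + 1) := by
  rw [Finset.sum_range_succ']
  have h : ∀ j, (-1 : ℝ) ^ (j + 1) * u (j + 1) = -((-1 : ℝ) ^ j * u (j + 1)) := fun j => by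
    rw [pow_succ]; ring
  simp only [h, Finset.sum_neg_distrib, pow_zero, one_mul]
  ring

/-- Alternating partial sums of an antitone nonnegative sequence lie in `[0, u_0]` (Leibniz
bracketing). [folklore] -/
theorem altSum_bounds : ∀ (M : ℕ) (u : ℕ → ℝ), Antitone u → (∀ j, 0 ≤ u j) →
    0 ≤ ∑ j ∈ Finset.range M, (-1 : ℝ) ^ j * u j ∧
      ∑ j ∈ Finset.range M, (-1 : ℝ) ^ j * u j ≤ u 0 := by
  intro M
  induction M with
  | zero => intro u _ hu0; simp [hu0 0]
  | succ M ih =>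
    intro u hu hu0
    rw [altSum_succ]
    have h := ih (fun j => u (j + 1)) (fun i j hij => hu (by omega)) (fun j => hu0 _)
    have h01 : u 1 ≤ u 0 := hu (by omega)
    constructor <;> linarith [h.1, h.2]

/-- A nonempty alternating partial sum of an antitone nonnegative sequence is `≥ v_0 - v_1`.
[folklore] -/
theorem altSum_lower_one (v : ℕ → ℝ) (hv : Antitone v) (hv0 : ∀ j, 0 ≤ v j) (L : ℕ)
    (hL : 1 ≤ L) : v 0 - v 1 ≤ ∑ j ∈ Finset.range L, (-1 : ℝ) ^ j * v j := by
  obtain ⟨L', rfl⟩ : ∃ L', L = L' + 1 := ⟨L - 1, by omega⟩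
  rw [altSum_succ]
  have h := (altSum_bounds L' (fun j => v (j + 1)) (fun i j hij => hv (by omega))
    (fun j => hv0 _)).2
  linarith

/-- An alternating partial sum with at least three terms of an antitone nonnegative sequence is
`≥ v_0 - v_1 + (v_2 - v_3)`. [folklore] -/
theorem altSum_lower_three (v : ℕ → ℝ) (hv : Antitone v) (hv0 : ∀ j, 0 ≤ v j) (L : ℕ)
    (hL : 3 ≤ L) :
    v 0 - v 1 + (v 2 - v 3) ≤ ∑ j ∈ Finset.range L, (-1 : ℝ) ^ j * v j := by
  obtain ⟨L', rfl⟩ : ∃ L', L = L' + 1 + 1 + 1 := ⟨L - 3, by omega⟩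
  rw [altSum_succ, altSum_succ, altSum_succ]
  have h := (altSum_bounds L' (fun j => v (j + 1 + 1 + 1)) (fun i j hij => hv (by omega))
    (fun j => hv0 _)).2
  linarith

/-- Left alternating sums `D p = (-1)^p Σ_{k ≤ p} (-1)^k T_k` of a positive sequence that at
least doubles at each step up to index `m + 1`: `0 < D p ≤ T p`, strictly below `T p` for
`p ≥ 1` (since `D (p+1) = T (p+1) - D p`). [folklore] -/
theorem leftAlt_bounds (T : ℕ → ℝ) (m : ℕ) (hpos : ∀ k, 0 < T k)
    (hstep : ∀ k, k ≤ m → 2 * T k ≤ T (k + 1)) :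
    ∀ p, p ≤ m + 1 →
      0 < (-1 : ℝ) ^ p * ∑ k ∈ Finset.range (p + 1), (-1 : ℝ) ^ k * T k ∧
      (-1 : ℝ) ^ p * ∑ k ∈ Finset.range (p + 1), (-1 : ℝ) ^ k * T k ≤ T p ∧
      (1 ≤ p →
        (-1 : ℝ) ^ p * ∑ k ∈ Finset.range (p + 1), (-1 : ℝ) ^ k * T k < T p) := by
  intro p
  induction p with
  | zero =>
    intro _
    simp only [pow_zero, zero_add, Finset.range_one, Finset.sum_singleton, one_mul]
    exact ⟨hpos 0, le_rfl, fun h => absurd h (by norm_num)⟩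
  | succ p ih =>
    intro hp
    obtain ⟨ih1, ih2, -⟩ := ih (by omega)
    have hrec : (-1 : ℝ) ^ (p + 1) * ∑ k ∈ Finset.range (p + 1 + 1), (-1 : ℝ) ^ k * T k
        = T (p + 1) - (-1 : ℝ) ^ p * ∑ k ∈ Finset.range (p + 1), (-1 : ℝ) ^ k * T k := by
      rw [Finset.sum_range_succ, mul_add, pow_succ]
      have h2 : ((-1 : ℝ) ^ p * -1) * ((-1 : ℝ) ^ p * -1 * T (p + 1)) = T (p + 1) := by
        have : ((-1 : ℝ) ^ p * -1) * ((-1 : ℝ) ^ p * -1 * T (p + 1))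
            = ((-1 : ℝ) ^ p * (-1) ^ p) * T (p + 1) := by ring
        rw [this, ← pow_add, ← two_mul, pow_mul]
        norm_num
      rw [h2]
      ring
    rw [hrec]
    have hs := hstep p (by omega)
    have hp0 := hpos p
    exact ⟨by linarith, by linarith, fun _ => by linarith⟩

/-! ### Sign of the sections at the points `-2 a_m / a_{m+1}` -/

/-- **Hutchinson's sign pattern.** If `a_k > 0` and `a_{n-1}^2 ≥ 4 a_{n-2} a_n` (`n ≥ 2`), then
for `N ≥ 3` and `1 ≤ m+1 ≤ N` the section `S_N(x) = Σ_{k ≤ N} a_k x^k` satisfies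
`(-1)^{m+1} S_N(-2 a_m / a_{m+1}) > 0`: at `r = 2 a_m/a_{m+1}` the term `a_{m+1} r^{m+1}` dominates
the alternating sum. [cite: Hutchinson1923, main theorem (Trans. AMS 25, pp. 325–332), proof] -/
theorem sign_at (a : ℕ → ℝ) (ha : ∀ k, 0 < a k)
    (hq : ∀ n : ℕ, 2 ≤ n → 4 * (a (n - 2) * a n) ≤ a (n - 1) ^ 2)
    {N m : ℕ} (hN : 3 ≤ N) (hm : m + 1 ≤ N) :
    0 < (-1 : ℝ) ^ (m + 1) *
      ∑ k ∈ Finset.range (N + 1), a k * (-(2 * (a m / a (m + 1)))) ^ k := by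
  have hy4 : ∀ k, 4 * (a k / a (k + 1)) ≤ a (k + 1) / a (k + 2) := by
    intro k
    have h := hq (k + 2) (by omega)
    rw [show k + 2 - 2 = k by omega, show k + 2 - 1 = k + 1 by omega] at h
    rw [mul_div_assoc', div_le_div_iff₀ (ha _) (ha _)]
    nlinarith [h]
  have hymono : Monotone fun k => a k / a (k + 1) := by
    refine monotone_nat_of_le_succ fun k => ?_
    have h1 := hy4 k
    have h2 : 0 < a k / a (k + 1) := div_pos (ha _) (ha _)
    show a k / a (k + 1) ≤ a (k + 1) / a (k + 1 + 1)
    linarith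
  set r : ℝ := 2 * (a m / a (m + 1)) with hr
  have rpos : 0 < r := by
    have h1 := ha m
    have h2 := ha (m + 1)
    rw [hr]
    positivity
  set T : ℕ → ℝ := fun k => a k * r ^ k with hT
  have Tpos : ∀ k, 0 < T k := fun k => by
    have h1 := ha k
    show 0 < a k * r ^ k
    positivity
  have T4 : T (m + 1) = 2 * T m := by
    have h1 : a (m + 1) ≠ 0 := (ha _).ne'
    simp only [hT, hr, pow_succ]
    field_simp
  have T2 : ∀ k, k ≤ m → 2 * T k ≤ T (k + 1) := by
    intro k hk
    have hy : a k / a (k + 1) ≤ a m / a (m + 1) := hymono hk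
    rw [div_le_iff₀ (ha _)] at hy
    have h1 : 2 * a k ≤ a (k + 1) * r := by rw [hr]; nlinarith [ha (k + 1)]
    simp only [hT, pow_succ]
    nlinarith [pow_pos rpos k]
  have T3 : ∀ k, m + 1 ≤ k → 2 * T (k + 1) ≤ T k := by
    intro k hk
    have hy : 4 * (a m / a (m + 1)) ≤ a k / a (k + 1) := (hy4 m).trans (hymono hk)
    rw [le_div_iff₀ (ha _)] at hy
    have h1 : 2 * (a (k + 1) * r) ≤ a k := by rw [hr]; nlinarith [ha (k + 1)]
    simp only [hT, pow_succ]
    nlinarith [pow_pos rpos k]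
  have hS : ∑ k ∈ Finset.range (N + 1), a k * (-r) ^ k
      = ∑ k ∈ Finset.range (N + 1), (-1 : ℝ) ^ k * T k := by
    refine Finset.sum_congr rfl fun k _ => ?_
    simp only [hT]
    rw [neg_pow]
    ring
  rw [hS, ← Finset.sum_range_add_sum_Ico _ (show m + 1 ≤ N + 1 by omega), mul_add]
  have hL : (-1 : ℝ) ^ (m + 1) * ∑ k ∈ Finset.range (m + 1), (-1 : ℝ) ^ k * T k
      = -((-1 : ℝ) ^ m * ∑ k ∈ Finset.range (m + 1), (-1 : ℝ) ^ k * T k) := by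
    rw [pow_succ]
    ring
  set v : ℕ → ℝ := fun j => T (m + 1 + j) with hv
  have hR : (-1 : ℝ) ^ (m + 1) * ∑ k ∈ Finset.Ico (m + 1) (N + 1), (-1 : ℝ) ^ k * T k
      = ∑ j ∈ Finset.range (N - m), (-1 : ℝ) ^ j * v j := by
    rw [Finset.sum_Ico_eq_sum_range, show N + 1 - (m + 1) = N - m by omega, Finset.mul_sum]
    refine Finset.sum_congr rfl fun j _ => ?_
    simp only [hv]
    rw [← mul_assoc, ← pow_add, show m + 1 + (m + 1 + j) = 2 * (m + 1) + j by omega, pow_add,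
      pow_mul]
    norm_num
  rw [hL, hR]
  have hv_anti : Antitone v := by
    refine antitone_nat_of_succ_le fun j => ?_
    have h := T3 (m + 1 + j) (by omega)
    have h0 := Tpos (m + 1 + j + 1)
    show T (m + 1 + (j + 1)) ≤ T (m + 1 + j)
    rw [show m + 1 + (j + 1) = m + 1 + j + 1 by omega]
    linarith
  have hv0 : ∀ j, 0 ≤ v j := fun j => (Tpos _).le
  obtain ⟨hD0, hD1, hD2⟩ := leftAlt_bounds T m Tpos T2 m (by omega)
  have hv00 : v 0 = 2 * T m := T4
  have hv01 : 2 * v 1 ≤ v 0 := T3 (m + 1) le_rfl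
  rcases Nat.eq_zero_or_pos m with hm0 | hmpos
  · have hV := altSum_lower_three v hv_anti hv0 (N - m) (by omega)
    have hv23 : 2 * v 3 ≤ v 2 := T3 (m + 1 + 2) (by omega)
    have hv3 : 0 < v 3 := Tpos _
    linarith
  · have hV := altSum_lower_one v hv_anti hv0 (N - m) (by omega)
    have hD := hD2 hmpos
    linarith

/-! ### The sections `Σ_{k ≤ N} a_k z^k`, `N ≥ 3`, have only real negative zeros -/

/-- **Sections have only simple negative zeros** (Hutchinson's condition (ii) for the sections,
with the root count): under `a_k > 0`, `a_{n-1}^2 ≥ 4 a_{n-2} a_n`, every complex zero of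
`Σ_{k ≤ N} a_k z^k` (`N ≥ 3`) is real and negative — `N` sign changes at the points
`0, -2a_0/a_1, …, -2a_{N-1}/a_N` give `N` distinct negative roots, and a degree-`N` polynomial has
no further root. [cite: Hutchinson1923, main theorem (Trans. AMS 25, pp. 325–332), part (ii)] -/
theorem sections_zero_real_neg (a : ℕ → ℝ) (ha : ∀ k, 0 < a k)
    (hq : ∀ n : ℕ, 2 ≤ n → 4 * (a (n - 2) * a n) ≤ a (n - 1) ^ 2)
    {N : ℕ} (hN : 3 ≤ N) {z : ℂ}
    (hz : ∑ k ∈ Finset.range (N + 1), (a k : ℂ) * z ^ k = 0) : z.im = 0 ∧ z.re < 0 := by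
  -- evaluation points `e 0 = 0`, `e (m+1) = 2 a_m / a_{m+1}`
  set e : ℕ → ℝ := fun p => if p = 0 then 0 else 2 * (a (p - 1) / a p) with he
  -- the real section
  set S : ℝ → ℝ := fun x => ∑ k ∈ Finset.range (N + 1), a k * x ^ k with hS
  have hSC : ∀ x : ℝ,
      ∑ k ∈ Finset.range (N + 1), (a k : ℂ) * (x : ℂ) ^ k = (S x : ℂ) := by
    intro x
    simp only [hS]
    push_cast
    rfl
  have hsign : ∀ p, p ≤ N → 0 < (-1 : ℝ) ^ p * S (-(e p)) := by
    intro p hp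
    rcases p with _ | m
    · have h0 : S 0 = a 0 := by
        simp only [hS]
        rw [Finset.sum_eq_single 0]
        · simp
        · intro k _ hk
          simp [hk]
        · intro h
          simp at h
      simp only [he, if_true, neg_zero, pow_zero, one_mul, h0]
      exact ha 0
    · have h := sign_at a ha hq hN hp
      have he' : e (m + 1) = 2 * (a m / a (m + 1)) := by
        simp only [he, if_neg (Nat.succ_ne_zero m), Nat.add_sub_cancel]
      rw [he']
      exact h
  have he0 : ∀ p, 0 ≤ e p := by
    intro p
    rcases p with _ | m
    · simp [he]
    · simp only [he, if_neg (Nat.succ_ne_zero m), Nat.add_sub_cancel]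
      have h1 := ha m
      have h2 := ha (m + 1)
      positivity
  have hy4 : ∀ k, 4 * (a k / a (k + 1)) ≤ a (k + 1) / a (k + 2) := by
    intro k
    have h := hq (k + 2) (by omega)
    rw [show k + 2 - 2 = k by omega, show k + 2 - 1 = k + 1 by omega] at h
    rw [mul_div_assoc', div_le_div_iff₀ (ha _) (ha _)]
    nlinarith [h]
  have hemono : StrictMono e := by
    refine strictMono_nat_of_lt_succ fun p => ?_
    rcases p with _ | m
    · simp only [he, if_true, if_neg (Nat.succ_ne_zero 0)]
      have h1 := ha (0 + 1 - 1)
      have h2 := ha (0 + 1)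
      positivity
    · simp only [he, if_neg (Nat.succ_ne_zero m), if_neg (Nat.succ_ne_zero (m + 1)),
        Nat.add_sub_cancel]
      have h1 := hy4 m
      have h2 : 0 < a m / a (m + 1) := div_pos (ha _) (ha _)
      linarith
  have hScont : Continuous S := by
    simp only [hS]
    fun_prop
  -- one root in each interval `(-e (i+1), -e i)`, `i < N`
  have hroot : ∀ i, i < N → ∃ x : ℝ, -(e (i + 1)) < x ∧ x < -(e i) ∧ S x = 0 := by
    intro i hi
    have h1 := hsign (i + 1) hi
    have h2 := hsign i (by omega)
    have hab : -(e (i + 1)) ≤ -(e i) := by linarith [hemono (Nat.lt_succ_self i)]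
    have hgc : ContinuousOn (fun x => (-1 : ℝ) ^ i * S x) (Set.Icc (-(e (i + 1))) (-(e i))) :=
      (continuous_const.mul hScont).continuousOn
    have hga : (-1 : ℝ) ^ i * S (-(e (i + 1))) < 0 := by
      rw [pow_succ] at h1
      linarith
    obtain ⟨x, hx, hx0⟩ := intermediate_value_Ioo hab hgc ⟨hga, h2⟩
    refine ⟨x, hx.1, hx.2, ?_⟩
    rcases mul_eq_zero.1 hx0 with h | h
    · exact absurd h (pow_ne_zero _ (by norm_num))
    · exact h
  choose! ρ hρ using hroot
  have hρinj : ∀ i j, i < N → j < N → ρ i = ρ j → i = j := by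
    intro i j hi hj hij
    by_contra hne
    rcases Nat.lt_or_gt_of_ne hne with h | h
    · have h1 := (hρ j hj).2.1
      have h2 := (hρ i hi).1
      have h3 : e (i + 1) ≤ e j := hemono.monotone h
      linarith
    · have h1 := (hρ i hi).2.1
      have h2 := (hρ j hj).1
      have h3 : e (j + 1) ≤ e i := hemono.monotone h
      linarith
  -- the polynomial and the root count
  set P : ℂ[X] := ∑ k ∈ Finset.range (N + 1), Polynomial.C ((a k : ℂ)) * Polynomial.X ^ k
    with hP
  have hPeval : ∀ w, P.eval w = ∑ k ∈ Finset.range (N + 1), (a k : ℂ) * w ^ k := by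
    intro w
    simp [hP, Polynomial.eval_finsetSum]
  have hPdeg : P.natDegree ≤ N := by
    rw [Polynomial.natDegree_le_iff_coeff_eq_zero]
    intro n hn
    simp only [hP, Polynomial.finsetSum_coeff, Polynomial.coeff_C_mul_X_pow]
    refine Finset.sum_eq_zero fun k hk => ?_
    rw [Finset.mem_range] at hk
    rw [if_neg (by omega)]
  have hPne : P ≠ 0 := by
    intro h0
    have h1 : P.coeff N = (a N : ℂ) := by
      simp only [hP, Polynomial.finsetSum_coeff, Polynomial.coeff_C_mul_X_pow]
      rw [Finset.sum_ite_eq]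
      simp
    rw [h0, Polynomial.coeff_zero] at h1
    have h2 : (a N : ℂ) ≠ 0 := by exact_mod_cast (ha N).ne'
    exact h2 h1.symm
  by_contra hcon
  have hzne : ∀ i, i < N → z ≠ (ρ i : ℂ) := by
    intro i hi heq
    apply hcon
    rw [heq]
    refine ⟨Complex.ofReal_im _, ?_⟩
    rw [Complex.ofReal_re]
    have h1 := (hρ i hi).2.1
    have h2 := he0 i
    linarith
  let f : Option (Fin N) → ℂ := fun o => o.elim z (fun i => (ρ i : ℂ))
  have hf : Function.Injective f := by
    intro o1 o2 h
    cases o1 with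
    | none =>
      cases o2 with
      | none => rfl
      | some j => exact absurd h (hzne j j.2)
    | some i =>
      cases o2 with
      | none => exact absurd h.symm (hzne i i.2)
      | some j =>
        have h' : (ρ i : ℂ) = (ρ j : ℂ) := h
        have h'' : ρ i = ρ j := by exact_mod_cast h'
        rw [Fin.ext (hρinj i j i.2 j.2 h'')]
  have heval : ∀ o, P.eval (f o) = 0 := by
    intro o
    cases o with
    | none =>
      show P.eval z = 0
      rw [hPeval]
      exact hz
    | some i =>
      show P.eval (ρ i : ℂ) = 0
      rw [hPeval, hSC]
      exact_mod_cast (hρ i i.2).2.2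
  have hcard : P.natDegree < Fintype.card (Option (Fin N)) := by
    simp only [Fintype.card_option, Fintype.card_fin]
    omega
  exact hPne (Polynomial.eq_zero_of_natDegree_lt_card_of_eval_eq_zero P hf heval hcard)

end Hutchinson1923

open Hutchinson1923 in
/-- **Hutchinson's theorem, forward direction** (discharge of `Hutchinson1923_thmB`): the sections
`Σ_{k≤N} a_k z^k` (`N ≥ 3`) take the sign `(-1)^m` at `-2a_{m-1}/a_m`, hence have `N` simple
negative zeros and no others; a zero of the entire `f` off the negative axis would contradict the
maximum modulus principle for `1/S_N` on a small disc (Hurwitz).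
Statement as quoted by Nguyen–Vishnyakova (2019), p. 3 Thm. B (i), without simplicity.
[cite: Hutchinson1923, main theorem (Trans. AMS 25, pp. 325–332)] -/
theorem Hutchinson1923_thmB_holds : Hutchinson1923_thmB := by
  intro a ha hq hsum z₀ hz₀
  set F : ℂ → ℂ := fun z => ∑' k, (a k : ℂ) * z ^ k with hF
  have hFz₀ : F z₀ = 0 := hz₀
  have hsumR : ∀ R : ℝ, Summable fun k => a k * R ^ k := by
    intro R
    have h := hsum (R : ℂ)
    rw [← Complex.summable_ofReal]
    push_cast
    exact h
  have hbound :
      ∀ (R : ℝ) (k : ℕ) (w : ℂ), ‖w‖ ≤ R → ‖(a k : ℂ) * w ^ k‖ ≤ a k * R ^ k := by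
    intro R k w hw
    rw [norm_mul, norm_pow, Complex.norm_real, Real.norm_of_nonneg (ha k).le]
    have h1 := ha k
    gcongr
  have hdiff : Differentiable ℂ F := by
    intro w
    have hR : w ∈ Metric.ball (0 : ℂ) (‖w‖ + 1) := by simp
    have hd : DifferentiableOn ℂ F (Metric.ball 0 (‖w‖ + 1)) := by
      apply Complex.differentiableOn_tsum_of_summable_norm (hsumR (‖w‖ + 1))
      · intro k
        fun_prop
      · exact Metric.isOpen_ball
      · intro k x hx
        exact hbound _ k x (le_of_lt (by simpa using hx))
    exact hd.differentiableAt (Metric.isOpen_ball.mem_nhds hR)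
  have hF0 : F 0 = a 0 := by
    simp only [hF]
    rw [tsum_eq_single 0]
    · simp
    · intro k hk
      simp [hk]
  have ha0 : (a 0 : ℂ) ≠ 0 := by exact_mod_cast (ha 0).ne'
  have hz₀ne : z₀ ≠ 0 := by
    intro h
    rw [h, hF0] at hFz₀
    exact ha0 hFz₀
  by_contra hneg
  -- a ball around `z₀` missing the closed negative real axis
  obtain ⟨δ, hδpos, hδ⟩ :
      ∃ δ > 0, ∀ z : ℂ, dist z z₀ < δ → ¬(z.im = 0 ∧ z.re < 0) := by
    by_cases him : z₀.im = 0
    · have hre : 0 < z₀.re := by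
        rcases lt_trichotomy z₀.re 0 with h | h | h
        · exact absurd ⟨him, h⟩ hneg
        · exact absurd (Complex.ext h him) hz₀ne
        · exact h
      refine ⟨z₀.re, hre, fun z hz ⟨_, hzre⟩ => ?_⟩
      have h1 := Complex.abs_re_le_norm (z - z₀)
      rw [Complex.sub_re, ← dist_eq_norm] at h1
      have h2 := (abs_lt.1 (lt_of_le_of_lt h1 hz)).1
      linarith
    · refine ⟨|z₀.im|, abs_pos.2 him, fun z hz ⟨hzim, _⟩ => ?_⟩
      have h1 := Complex.abs_im_le_norm (z - z₀)
      rw [Complex.sub_im, hzim, zero_sub, abs_neg, ← dist_eq_norm] at h1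
      linarith
  -- isolated zeros: `F ≠ 0` on a punctured ball around `z₀`
  have han : AnalyticAt ℂ F z₀ := hdiff.analyticAt z₀
  obtain ⟨ε, hεpos, hε⟩ :
      ∃ ε > 0, ∀ z : ℂ, dist z z₀ < ε → z ≠ z₀ → F z ≠ 0 := by
    rcases han.eventually_eq_zero_or_eventually_ne_zero with h | h
    · exfalso
      have hAN : AnalyticOnNhd ℂ F Set.univ := fun w _ => hdiff.analyticAt w
      have h1 := hAN.eqOn_zero_of_preconnected_of_eventuallyEq_zero isPreconnected_univ
        (Set.mem_univ z₀) h
      have h00 := h1 (Set.mem_univ 0)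
      simp only [Pi.zero_apply] at h00
      rw [hF0] at h00
      exact ha0 h00
    · rw [eventually_nhdsWithin_iff, Metric.eventually_nhds_iff] at h
      obtain ⟨ε, hε, h⟩ := h
      exact ⟨ε, hε, fun z hz hne => h hz hne⟩
  set ρ : ℝ := min ε δ / 2 with hρ
  have hρpos : 0 < ρ := by positivity
  have hρε : ρ < ε := by
    have := min_le_left ε δ
    rw [hρ]
    linarith
  have hρδ : ρ < δ := by
    have := min_le_right ε δ
    rw [hρ]
    linarith
  have hcontF : Continuous F := hdiff.continuous
  obtain ⟨w, hwS, hwmin⟩ := (isCompact_sphere z₀ ρ).exists_isMinOn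
    (NormedSpace.sphere_nonempty.2 hρpos.le) hcontF.norm.continuousOn
  set η : ℝ := ‖F w‖ with hη
  have hηpos : 0 < η := by
    have hwz : dist w z₀ = ρ := Metric.mem_sphere.1 hwS
    have hne : w ≠ z₀ := by
      intro h
      rw [h, dist_self] at hwz
      linarith
    exact norm_pos_iff.2 (hε w (by linarith) hne)
  have hmin : ∀ z ∈ Metric.sphere z₀ ρ, η ≤ ‖F z‖ := fun z hz => hwmin hz
  -- uniform convergence of the sections on the closed ball
  have hunif : TendstoUniformlyOn (fun n x => ∑ k ∈ Finset.range n, (a k : ℂ) * x ^ k) F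
      Filter.atTop (Metric.closedBall z₀ ρ) := by
    apply tendstoUniformlyOn_tsum_nat (hsumR (‖z₀‖ + ρ))
    intro k x hx
    exact hbound _ k x (norm_le_norm_add_const_of_dist_le (Metric.mem_closedBall.1 hx))
  rw [Metric.tendstoUniformlyOn_iff] at hunif
  have hev := hunif (η / 2) (by positivity)
  rw [Filter.eventually_atTop] at hev
  obtain ⟨N₀, hN₀⟩ := hev
  set N : ℕ := max N₀ 4 - 1 with hNdef
  have hN3 : 3 ≤ N := by omega
  have hNN₀ : N₀ ≤ N + 1 := by omega
  have happrox := hN₀ (N + 1) hNN₀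
  set S : ℂ → ℂ := fun x => ∑ k ∈ Finset.range (N + 1), (a k : ℂ) * x ^ k with hSdef
  have happrox' : ∀ x ∈ Metric.closedBall z₀ ρ, dist (F x) (S x) < η / 2 := happrox
  have hSne : ∀ x ∈ Metric.closedBall z₀ ρ, S x ≠ 0 := by
    intro x hx h0
    have h1 := sections_zero_real_neg a ha hq hN3 h0
    exact hδ x (lt_of_le_of_lt (Metric.mem_closedBall.1 hx) hρδ) h1
  have hSdiff : Differentiable ℂ S := by
    simp only [hSdef]
    fun_prop
  have hG : DiffContOnCl ℂ (fun x => (S x)⁻¹) (Metric.ball z₀ ρ) := by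
    refine ⟨hSdiff.differentiableOn.inv fun x hx =>
      hSne x (Metric.ball_subset_closedBall hx), ?_⟩
    rw [closure_ball z₀ hρpos.ne']
    exact hSdiff.continuous.continuousOn.inv₀ hSne
  have hfront : ∀ x ∈ frontier (Metric.ball z₀ ρ), ‖(S x)⁻¹‖ ≤ (η / 2)⁻¹ := by
    rw [frontier_ball z₀ hρpos.ne']
    intro x hx
    have h1 := hmin x hx
    have h2 := happrox' x (Metric.sphere_subset_closedBall hx)
    rw [dist_eq_norm] at h2
    have h3 : η / 2 ≤ ‖S x‖ := by
      have := norm_sub_norm_le (F x) (S x)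
      linarith
    rw [norm_inv]
    exact inv_anti₀ (by positivity) h3
  have hmax := Complex.norm_le_of_forall_mem_frontier_norm_le Metric.isBounded_ball hG hfront
    (subset_closure (Metric.mem_ball_self hρpos))
  have hSz₀ : S z₀ ≠ 0 := hSne z₀ (Metric.mem_closedBall_self hρpos.le)
  rw [norm_inv] at hmax
  have h4 : η / 2 ≤ ‖S z₀‖ :=
    (inv_le_inv₀ (norm_pos_iff.2 hSz₀) (by positivity)).1 hmax
  have h5 := happrox' z₀ (Metric.mem_closedBall_self hρpos.le)
  rw [hFz₀, dist_eq_norm, zero_sub, norm_neg] at h5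
  linarith

end Literature.Analysis.Complex

end
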